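import Mathlib.NumberTheory.DirichletCharacter.Basic
import Mathlib.NumberTheory.LegendreSymbol.JacobiSymbol
import Mathlib.NumberTheory.MulChar.Lemmas
import Mathlib.Data.ZMod.Units
import Mathlib.FieldTheory.Finite.Basic
import HarnessLib

/-!
# The primitive quadratic Dirichlet character modulo an odd squarefree `q` is the Jacobi symbol

Topic `Literature/NumberTheory/LFunctions`. Everything in this file is PROVED (theorems only).

For an odd squarefree modulus `q`, the Dirichlet characters mod `q` with values in `{0, ±1}` are
the `2^{ω(q)}` products of Legendre symbols `(·/ℓ)` over subsets of the prime factors `ℓ ∣ q`,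
and exactly one of them is primitive: the Jacobi symbol `n ↦ (n/q)`, which for `q ≡ 3 (mod 4)`
is the Kronecker symbol `(−q/·)` of the imaginary quadratic field of discriminant `−q`
(Davenport, *Multiplicative Number Theory*, Ch. 5; Montgomery–Vaughan §9.3). We prove the
uniqueness half, which is what is needed to identify "the primitive quadratic character mod
`|d|`" of the tree's statements on Siegel zeros (`Literature/Barriers/Parity/SiegelZero*.lean`)
with the character `(d/·)` of the printed sources:

* `apply_eq_legendreSym_of_cast_eq_one` — if `q = p·m` with `p ∤ m` an odd prime and `χ` is a
  primitive character mod `q` with `χ(a) ∈ {0, ±1}`, then `χ(a) = (a/p)` for every `a ≡ 1 (mod m)`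
  (the `p`-component of `χ` is a non-trivial quadratic character of the cyclic group `(ℤ/p)ˣ`,
  non-trivial because otherwise `χ` would factor through `m`);
* `apply_natCast_eq_jacobiSym` — for `q` odd and squarefree and `χ` primitive quadratic mod `q`,
  `χ(n) = (n/q)` for every `n : ℕ` (Chinese remainder theorem: `n ≡ ∏_ℓ a_ℓ` with
  `a_ℓ ≡ n (mod ℓ)`, `a_ℓ ≡ 1 (mod q/ℓ)`);
* `jacobiSym_neg_eq_jacobiSym_of_mod_four` — quadratic reciprocity in the form
  `(−q/p) = (p/q)` for `q ≡ 3 (mod 4)` and `p` an odd prime, so that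
  `apply_prime_eq_legendreSym_neg`: `χ(p) = (d/p)` with `d = −q ≡ 1 (mod 4)`.

## References

* H. Davenport, *Multiplicative Number Theory*, 3rd ed., GTM 74 (2000), Ch. 5 (primitive real
  characters are the Kronecker symbols of fundamental discriminants).
* H. L. Montgomery, R. C. Vaughan, *Multiplicative Number Theory I*, CUP (2007), §9.3,
  Theorem 9.13.
-/

noncomputable section

open DirichletCharacter

namespace Literature.NumberTheory.LFunctions.PrimitiveQuadratic

/-! ### The `p`-component of a character mod `p·m` -/

/-- The Chinese remainder isomorphism `ZMod (p m) ≃ ZMod p × ZMod m` is reduction in each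
component. [folklore] -/
theorem chineseRemainder_apply {p m : ℕ} (h : p.Coprime m) (x : ZMod (p * m)) :
    ZMod.chineseRemainder h x = ((ZMod.cast x : ZMod p), (ZMod.cast x : ZMod m)) := by
  simp only [ZMod.chineseRemainder]
  ext <;> simp

/-- The image of an integer under the Chinese remainder isomorphism. [folklore] -/
theorem chineseRemainder_intCast {p m : ℕ} (h : p.Coprime m) (a : ℤ) :
    ZMod.chineseRemainder h (a : ZMod (p * m)) = ((a : ZMod p), (a : ZMod m)) := by
  rw [map_intCast]; rfl

/-- **The `p`-component of a primitive character is non-trivial.** Let `χ` be a Dirichlet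
character mod `p·m` with `(p, m) = 1`, `p` prime. If `χ(x) = 1` for every unit `x ≡ 1 (mod m)`,
then `χ` factors through `m` (`DirichletCharacter.factorsThrough_iff_ker_unitsMap`); hence if `χ`
is primitive, some `x ≡ 1 (mod m)` has `χ(x) ≠ 1`. [folklore] -/
theorem exists_apply_ne_one_of_isPrimitive {p m : ℕ} [NeZero (p * m)] (hp : p.Prime)
    {χ : DirichletCharacter ℂ (p * m)} (hprim : χ.IsPrimitive) :
    ∃ x : (ZMod (p * m))ˣ, (ZMod.cast (x : ZMod (p * m)) : ZMod m) = 1 ∧ χ x ≠ 1 := by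
  by_contra! hall
  have hft : χ.FactorsThrough m := by
    rw [factorsThrough_iff_ker_unitsMap (Dvd.intro_left p rfl)]
    intro x hx
    rw [MonoidHom.mem_ker, ZMod.unitsMap_def, Units.ext_iff, Units.coe_map, MonoidHom.coe_coe,
      ZMod.castHom_apply, Units.val_one] at hx
    rw [MonoidHom.mem_ker, Units.ext_iff, MulChar.coe_toUnitHom, Units.val_one]
    exact hall x hx
  have hdvd : χ.conductor ∣ m := conductor_dvd_of_mem_conductorSet χ ((mem_conductorSet_iff χ).2 hft)
  rw [hprim] at hdvd
  have hm : 0 < m := Nat.pos_of_ne_zero fun hm => by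
    subst hm; exact (NeZero.ne (p * 0)) (mul_zero p)
  have hle := Nat.le_of_dvd hm hdvd
  have : p * m ≥ 2 * m := Nat.mul_le_mul_right m hp.two_le
  omega

/-! ### Quadratic characters of `ZMod p` -/

/-- A non-trivial multiplicative character of `ZMod p` (`p` an odd prime) with values in
`{0, ±1} ⊂ ℂ` is the Legendre symbol: both take the value `−1` at a generator of the cyclic group
`(ℤ/p)ˣ` (`MulChar.eq_iff`). [folklore] -/
theorem eq_quadraticChar_of_isQuadratic {p : ℕ} [Fact p.Prime] (hp2 : p ≠ 2)
    {ψ : MulChar (ZMod p) ℂ} (hψ : ψ.IsQuadratic) (hψ1 : ψ ≠ 1) :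
    ψ = (quadraticChar (ZMod p)).ringHomComp (Int.castRingHom ℂ) := by
  set lam := (quadraticChar (ZMod p)).ringHomComp (Int.castRingHom ℂ) with hlam
  have hlam1 : lam ≠ 1 :=
    (MulChar.ringHomComp_ne_one_iff (f := Int.castRingHom ℂ) Int.cast_injective).2
      (quadraticChar_ne_one (by rw [ZMod.ringChar_zmod_n]; exact hp2))
  have hlamq : lam.IsQuadratic := (quadraticChar_isQuadratic (F := ZMod p)).comp _
  obtain ⟨g, hg⟩ := IsCyclic.exists_generator (α := (ZMod p)ˣ)
  -- a quadratic character `≠ 1` takes the value `-1` at the generator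
  have key : ∀ φ : MulChar (ZMod p) ℂ, φ.IsQuadratic → φ ≠ 1 → φ (g : ZMod p) = -1 := by
    intro φ hφ hφ1
    rcases hφ (g : ZMod p) with h0 | h1 | hm1
    · exact absurd h0 (IsUnit.ne_zero ((Units.isUnit g).map φ))
    · exact absurd ((MulChar.eq_iff hg φ 1).2 (by rw [h1, MulChar.one_apply_coe])) hφ1
    · exact hm1
  exact (MulChar.eq_iff hg ψ lam).2 (by rw [key ψ hψ hψ1, key lam hlamq hlam1])

/-! ### The main identification -/

/-- **The `p`-component of a primitive quadratic character is the Legendre symbol.** Let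
`q = p·m` with `p` an odd prime, `(p, m) = 1`, and let `χ` be a primitive Dirichlet character
mod `q` with values in `{0, ±1}`. Then `χ(a) = (a/p)` for every integer `a ≡ 1 (mod m)`.
[folklore] -/
theorem apply_eq_legendreSym_of_cast_eq_one {p m q : ℕ} [Fact p.Prime] (hp2 : p ≠ 2) [NeZero q]
    (hq : p * m = q) (hpm : p.Coprime m) (χ : DirichletCharacter ℂ q) (hprim : χ.IsPrimitive)
    (hquad : χ.IsQuadratic) {a : ℤ} (ha : (a : ZMod m) = 1) :
    χ (a : ZMod q) = legendreSym p a := by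
  subst hq
  set e := ZMod.chineseRemainder hpm with he
  -- the `p`-component `ψ(u) = χ(x)`, `x ≡ u (mod p)`, `x ≡ 1 (mod m)`, as a multiplicative character
  let ψ : MulChar (ZMod p) ℂ :=
    { toFun := fun u => χ (e.symm (u, 1))
      map_one' := by
        rw [show ((1 : ZMod p), (1 : ZMod m)) = 1 from rfl, map_one, map_one]
      map_mul' := fun u v => by
        rw [← map_mul, show ((u * v : ZMod p), (1 : ZMod m)) = (u, 1) * (v, 1) by simp, map_mul]
      map_nonunit' := fun u hu => by
        apply χ.map_nonunit
        intro hunit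
        have h1 : IsUnit (e (e.symm (u, 1))) := IsUnit.map e (x := e.symm (u, 1)) hunit
        rw [RingEquiv.apply_symm_apply, Prod.isUnit_iff] at h1
        exact hu h1.1 }
  have hψ_apply : ∀ u : ZMod p, ψ u = χ (e.symm (u, 1)) := fun u => rfl
  -- every `x ≡ 1 (mod m)` is the CRT lift of `x mod p`
  have hlift : ∀ x : ZMod (p * m), (ZMod.cast x : ZMod m) = 1 →
      χ x = ψ (ZMod.cast x : ZMod p) := by
    intro x hx
    rw [hψ_apply]
    congr 1
    apply e.injective
    rw [RingEquiv.apply_symm_apply, he, chineseRemainder_apply, hx]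
  have hψq : ψ.IsQuadratic := fun u => hquad _
  have hψ1 : ψ ≠ 1 := by
    obtain ⟨x, hx, hx1⟩ := exists_apply_ne_one_of_isPrimitive (Fact.out) hprim
    intro h1
    apply hx1
    rw [hlift x hx, h1]
    refine MulChar.one_apply ?_
    have hu : IsUnit (e (x : ZMod (p * m))) := x.isUnit.map _
    rw [he, chineseRemainder_apply, Prod.isUnit_iff] at hu
    exact hu.1
  have hψ := eq_quadraticChar_of_isQuadratic hp2 hψq hψ1
  have hx : (ZMod.cast (a : ZMod (p * m)) : ZMod m) = 1 := by
    rw [ZMod.cast_intCast (Dvd.intro_left p rfl), ha]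
  rw [hlift _ hx, hψ, MulChar.ringHomComp_apply, ZMod.cast_intCast (dvd_mul_right p m)]
  rfl

/-- For squarefree `q` and a prime `ℓ ∣ q`, `ℓ` is coprime to `q/ℓ`. [folklore] -/
theorem coprime_div_of_squarefree {q ℓ : ℕ} (hq : Squarefree q) (hℓ : ℓ.Prime) (hℓq : ℓ ∣ q) :
    ℓ.Coprime (q / ℓ) := by
  rw [hℓ.coprime_iff_not_dvd]
  intro h
  have : ℓ * ℓ ∣ q := by
    have := Nat.mul_dvd_mul_left ℓ h
    rwa [Nat.mul_div_cancel' hℓq] at this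
  exact (Nat.squarefree_iff_prime_squarefree.1 hq) ℓ hℓ this

/-- For squarefree `q` and distinct primes `ℓ, ℓ' ∣ q`, `ℓ ∣ q/ℓ'`. [folklore] -/
theorem dvd_div_of_ne {q ℓ ℓ' : ℕ} (hℓ : ℓ.Prime) (hℓ' : ℓ'.Prime) (hℓq : ℓ ∣ q) (hℓ'q : ℓ' ∣ q)
    (hne : ℓ ≠ ℓ') : ℓ ∣ q / ℓ' := by
  have hcop : ℓ.Coprime ℓ' := (Nat.coprime_primes hℓ hℓ').2 hne
  have : ℓ ∣ ℓ' * (q / ℓ') := by rwa [Nat.mul_div_cancel' hℓ'q]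
  exact hcop.dvd_of_dvd_mul_left this

/-- The Jacobi symbol over a product of distinct non-zero moduli is the product of the Jacobi
symbols (`jacobiSym.mul_right'`, iterated). [folklore] -/
theorem jacobiSym_finset_prod_right (a : ℤ) {s : Finset ℕ} (hs : ∀ b ∈ s, b ≠ 0) :
    jacobiSym a (∏ b ∈ s, b) = ∏ b ∈ s, jacobiSym a b := by
  classical
  induction s using Finset.induction_on with
  | empty => simp [jacobiSym.one_right]
  | insert b s hb ih =>
    rw [Finset.prod_insert hb, Finset.prod_insert hb,
      jacobiSym.mul_right' a (hs b (Finset.mem_insert_self b s))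
        (Finset.prod_ne_zero_iff.2 fun c hc => hs c (Finset.mem_insert_of_mem hc)),
      ih fun c hc => hs c (Finset.mem_insert_of_mem hc)]

/-- **A primitive quadratic character modulo an odd squarefree `q` is the Jacobi symbol**:
`χ(n) = (n/q)` for every natural number `n`. Proof: for `(n, q) > 1` both sides vanish; otherwise
pick, for each prime `ℓ ∣ q`, `a_ℓ ≡ n (mod ℓ)`, `a_ℓ ≡ 1 (mod q/ℓ)`; then `∏_ℓ a_ℓ ≡ n (mod q)`,
`χ(a_ℓ) = (a_ℓ/ℓ) = (n/ℓ)` by `apply_eq_legendreSym_of_cast_eq_one`, and `∏_ℓ (n/ℓ) = (n/q)`.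
[folklore] -/
theorem apply_natCast_eq_jacobiSym {q : ℕ} [NeZero q] (hodd : Odd q) (hsq : Squarefree q)
    (χ : DirichletCharacter ℂ q) (hprim : χ.IsPrimitive) (hquad : χ.IsQuadratic) (n : ℕ) :
    χ (n : ZMod q) = jacobiSym n q := by
  classical
  by_cases hcop : n.Coprime q
  swap
  · -- both sides vanish
    rw [MulChar.map_nonunit χ (by rwa [ZMod.isUnit_iff_coprime]),
      (jacobiSym.eq_zero_iff_not_coprime (a := (n : ℤ)) (b := q)).2 (by
        rwa [Int.gcd_natCast_natCast]), Int.cast_zero]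
  -- CRT representatives
  set S := q.primeFactors with hS
  have hSp : ∀ ℓ ∈ S, ℓ.Prime := fun ℓ hℓ => Nat.prime_of_mem_primeFactors hℓ
  have hSd : ∀ ℓ ∈ S, ℓ ∣ q := fun ℓ hℓ => Nat.dvd_of_mem_primeFactors hℓ
  set a : ℕ → ℕ := fun ℓ =>
    if hℓ : ℓ ∈ S then (Nat.chineseRemainder (coprime_div_of_squarefree hsq (hSp ℓ hℓ) (hSd ℓ hℓ))
      n 1 : ℕ) else 1 with ha
  have ha1 : ∀ ℓ ∈ S, a ℓ ≡ n [MOD ℓ] ∧ a ℓ ≡ 1 [MOD q / ℓ] := by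
    intro ℓ hℓ
    simp only [ha, dif_pos hℓ]
    exact (Nat.chineseRemainder _ n 1).2
  -- `∏ a_ℓ ≡ n (mod ℓ)` for every prime `ℓ ∣ q`
  have hmodℓ : ∀ ℓ ∈ S, ((∏ ℓ' ∈ S, a ℓ' : ℕ) : ZMod ℓ) = (n : ZMod ℓ) := by
    intro ℓ hℓ
    rw [Nat.cast_prod, Finset.prod_eq_single ℓ]
    · exact (ZMod.natCast_eq_natCast_iff _ _ _).2 (ha1 ℓ hℓ).1
    · intro ℓ' hℓ' hne
      have h1 : a ℓ' ≡ 1 [MOD q / ℓ'] := (ha1 ℓ' hℓ').2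
      have h2 : ℓ ∣ q / ℓ' := dvd_div_of_ne (hSp ℓ hℓ) (hSp ℓ' hℓ') (hSd ℓ hℓ) (hSd ℓ' hℓ') (Ne.symm hne)
      have h3 : a ℓ' ≡ 1 [MOD ℓ] := h1.of_dvd h2
      rw [← Nat.cast_one]
      exact (ZMod.natCast_eq_natCast_iff _ _ _).2 h3
    · intro h; exact absurd hℓ h
  -- hence `∏ a_ℓ ≡ n (mod q)`
  have hmodq : ((∏ ℓ' ∈ S, a ℓ' : ℕ) : ZMod q) = (n : ZMod q) := by
    rw [show ((∏ ℓ' ∈ S, a ℓ' : ℕ) : ZMod q) = (((∏ ℓ' ∈ S, a ℓ' : ℕ) : ℤ) : ZMod q) by push_cast; rfl,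
      show ((n : ℕ) : ZMod q) = (((n : ℕ) : ℤ) : ZMod q) by push_cast; rfl,
      ZMod.intCast_eq_intCast_iff_dvd_sub, Int.natCast_dvd, ← Nat.prod_primeFactors_of_squarefree hsq]
    refine Finset.prod_primes_dvd _ (fun ℓ hℓ => (hSp ℓ hℓ).prime) (fun ℓ hℓ => ?_)
    rw [← Int.natCast_dvd, ← ZMod.intCast_eq_intCast_iff_dvd_sub, Int.cast_natCast, Int.cast_natCast]
    exact hmodℓ ℓ hℓ
  -- evaluate
  rw [← hmodq, Nat.cast_prod, map_prod]
  conv_rhs => rw [← Nat.prod_primeFactors_of_squarefree hsq]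
  rw [jacobiSym_finset_prod_right _ (fun ℓ hℓ => (hSp ℓ hℓ).ne_zero), Int.cast_prod]
  refine Finset.prod_congr rfl fun ℓ hℓ => ?_
  haveI : Fact ℓ.Prime := ⟨hSp ℓ hℓ⟩
  have hℓ2 : ℓ ≠ 2 := by
    rintro rfl
    exact (Nat.not_even_iff_odd.mpr hodd) (even_iff_two_dvd.mpr (hSd 2 hℓ))
  have hcast : ((a ℓ : ℤ) : ZMod (q / ℓ)) = 1 := by
    have := (ZMod.natCast_eq_natCast_iff _ _ _).2 (ha1 ℓ hℓ).2
    push_cast at this ⊢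
    exact this
  have key := apply_eq_legendreSym_of_cast_eq_one hℓ2 (Nat.mul_div_cancel' (hSd ℓ hℓ))
    (coprime_div_of_squarefree hsq (hSp ℓ hℓ) (hSd ℓ hℓ)) χ hprim hquad hcast
  rw [Int.cast_natCast] at key
  have e : a ℓ % ℓ = n % ℓ := (ha1 ℓ hℓ).1
  have h : ((a ℓ : ℕ) : ℤ) % (ℓ : ℤ) = (n : ℤ) % ℓ := by
    rw [← Int.natCast_mod, e, Int.natCast_mod]
  rw [key, jacobiSym.legendreSym.to_jacobiSym, jacobiSym.mod_left' h]

/-! ### Quadratic reciprocity: `(−q/p) = (p/q)` for `q ≡ 3 (mod 4)` -/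

/-- For `q ≡ 3 (mod 4)` and `p` an odd prime (indeed any odd `p`), `(−q/p) = (p/q)`: by
`(−1/p) = χ₄(p)` and the reciprocity law `(q/p) = χ₄(p)·(p/q)` for `q ≡ 3 (mod 4)`
(cases `p ≡ 1, 3 (mod 4)`). This is the statement "the Kronecker symbol `(d/·)`, `d = −q ≡ 1
(mod 4)`, is the Jacobi symbol `(·/|d|)`" at odd arguments. [folklore] -/
theorem jacobiSym_neg_eq_jacobiSym_of_mod_four {q p : ℕ} (hq : q % 4 = 3) (hp : Odd p) :
    jacobiSym (-(q : ℤ)) p = jacobiSym (p : ℤ) q := by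
  rw [jacobiSym.neg _ hp, ZMod.χ₄_nat_eq_if_mod_four]
  have hp2 : p % 2 = 1 := Nat.odd_iff.mp hp
  rw [if_neg (by omega)]
  have h4 : p % 4 = 1 ∨ p % 4 = 3 := by omega
  rcases h4 with h1 | h3
  · rw [if_pos h1, jacobiSym.quadratic_reciprocity_one_mod_four' (Nat.odd_iff.mpr (by omega)) h1]
    ring
  · rw [if_neg (by omega), jacobiSym.quadratic_reciprocity_three_mod_four hq h3]
    ring

/-- **The primitive quadratic character mod `q = |d|` is `(d/·)` at odd primes.** For `q`
squarefree with `q ≡ 3 (mod 4)`, `χ` a primitive Dirichlet character mod `q` with values in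
`{0, ±1}`, and `p` an odd prime: `χ(p) = (−q/p)` (Legendre symbol of `d = −q` at `p`), the
coefficient pattern of the Kronecker character of the imaginary quadratic field of discriminant
`d`. [folklore] -/
theorem apply_prime_eq_legendreSym_neg {q : ℕ} [NeZero q] (hq : q % 4 = 3) (hsq : Squarefree q)
    (χ : DirichletCharacter ℂ q) (hprim : χ.IsPrimitive) (hquad : χ.IsQuadratic)
    (p : ℕ) [Fact p.Prime] (hp2 : p ≠ 2) :
    χ (p : ZMod q) = legendreSym p (-(q : ℤ)) := by
  have hodd : Odd q := Nat.odd_iff.mpr (by omega)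
  have hpodd : Odd p := (Fact.out : p.Prime).odd_of_ne_two hp2
  rw [apply_natCast_eq_jacobiSym hodd hsq χ hprim hquad p, jacobiSym.legendreSym.to_jacobiSym,
    jacobiSym_neg_eq_jacobiSym_of_mod_four hq hpodd]

end Literature.NumberTheory.LFunctions.PrimitiveQuadratic
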